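import Literature.Computability.AlgebraicComplexity.BDI20HwvEvaluationNPHardProofs
import Literature.Computability.Complexity.CanonicalCodes
import Literature.Computability.Cryptography.SubexponentialProofs
import HarnessLib

/-!
# Bläser–Dörfler–Ikenmeyer 2020/21, §8: a `2^{o(n)}` decider for a tableau problem puts it in `SE`
# (bridge from `BDI2020.HasSubexpDecider` to the Impagliazzo–Paturi–Zane class `SE`)

Theorem-only toolkit file of the cell `val-lit` (seat x6) on the way to the ETH clauses of BDI
CCC 2021 Thms 8.1/8.9 (`BDI2020_thm_8_1_eth`, `BDI2020_thm_8_9_eth`, typed in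
`BDI20HwvEvaluationHardness.lean`). No new named fact, no `instance`, no `notation`; the `def`s
below are bodied plumbing (a total decoder of tableau codes, its normalisation, the parameterised
problem). HONEST FRAMING: machine-model bookkeeping between two formalisations already in the
tree; nothing here bears on `VP ≠ VNP`, which is NOT proved.

## What is bridged

* `BDI2020.HasSubexpDecider S g` (BDI's "there is a `2^{o(g(n))}` algorithm", `n` = number of
  labels of the tableau instance): a multi-stack machine which, started on the CODE
  `tableauEncoding.encode T` of any tableau `T`, outputs the bit `[T ∈ S]` within `T'(g (numLabels
  T), L)` steps, for a two-parameter bound `T'` that is `O(2^{δ k} · poly(L))` for EVERY `δ > 0`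
  (`IsExpPolyBound`). Nothing is promised on strings that are not tableau codes.
* Impagliazzo–Paturi–Zane's `SE` (`Cryptography/Subexponential.lean`): a parameterised problem
  (language + parameter on ALL strings) decidable on every string within `poly(|x|) · 2^{ε p(x)}`
  for every `ε > 0`.

`BDI2020.subexpParam S g` is the parameterised problem with language `tableauEncoding.toLanguage S`
and parameter `g (numLabels T) - 1` on the code of `T` (junk value `0` off the codes,
`ParamProblem.ofEncoding`); the shift by one makes the parameter of a tableau on the single label
`0` equal to `0`, which is what a SERF reduction needs for the instances of parameter `0` of its
source problem (a harmless factor `2^ε` in the time bound).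

**`BDI2020.subexpParam_mem_SE`**: `T₀ ∉ S → HasSubexpDecider S g → subexpParam S g ∈ SE`. Proof
(Arora–Barak §1.3-style composition, no machine written): the polynomial-time front end
`x ↦ tableauEncoding.encode (tabNorm T₀ x)` — the identity on tableau codes and the code of the
fixed non-member `T₀` on every other string (canonical re-encoding `CanonCode.canonListFnC` of the
tree's total decoders, equality test, `CodeFP.ite`) — followed by the `HasSubexpDecider` machine
for the exponent `min ε 1` (`Turing.TM2ComputableAux.comp_outputsWithin`); the time accounting is
done in the `Gb` calculus of `SubexponentialProofs.lean`.

## References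
* [BlaserDorflerIkenmeyer2020] M. Bläser, J. Dörfler, C. Ikenmeyer, *On the complexity of
  evaluating highest weight vectors*, arXiv:2002.11594, Thms 22, 30 ("no `2^{o(n)}` algorithm …
  assuming ETH") = CCC 2021, LIPIcs 200:29, Thms 8.1, 8.9.
* [ImpagliazzoPaturiZaneJCSS2001] R. Impagliazzo, R. Paturi, F. Zane, *Which problems have strongly
  exponential complexity?*, JCSS 63 (2001), §2 (the class SE).
* [AroraBarak2009] S. Arora, B. Barak, *Computational Complexity: A Modern Approach*, CUP 2009,
  §0.1 (codes), §1.3 (composition of polynomial-time machines).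
-/

noncomputable section

open _root_.Computability

namespace Literature.Computability.AlgebraicComplexity

namespace BDI2020

open Literature.Computability.Complexity Literature.Computability.Cryptography
open CodeFP Brick CanonCode BDI20NPHard

/-! ### A total decoder of tableau codes and its canonical re-encoding in `FP` -/

/-- The list of naturals read off any string (total form of `encodingNatBool.listBool.decode`).
[cite: AroraBarak2009, §0.1 (codes of lists)] -/
def decNatList (u : List Bool) : List ℕ :=
  NegCNF.decList decodeNat (boolUnpair u).1.length (boolUnpair u).2

/-- **The tableau read off any string** (total form of `tableauEncoding.decode`).
[cite: AroraBarak2009, §0.1 (codes of lists)] -/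
def decTab (x : List Bool) : List (List ℕ) :=
  NegCNF.decList decNatList (boolUnpair x).1.length (boolUnpair x).2

/-- The numeral decoder is total. [folklore] -/
private theorem decode_nat (u : List Bool) : encodingNatBool.decode u = some (decodeNat u) := rfl

/-- `|canonF u| ≤ 1·|u| + 1`. [folklore] -/
private theorem length_canonF_le' (u : List Bool) : (canonF u).length ≤ 1 * u.length + 1 := by
  have := length_canonF_le u; omega

/-- Canonicalisation of codes of lists of naturals (clip `2 = 1 + 1`). [cite: AroraBarak2009, §0.1] -/
def canonNatListFn : List Bool → List Bool := canonListFnC 2 canonF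

/-- The decoder of lists of naturals is total, and `canonNatListFn` re-encodes. [cite: AroraBarak2009, §0.1 (codes of lists)] -/
theorem canonNatListFn_eq (u : List Bool) :
    encodingNatBool.listBool.decode u = some (decNatList u) ∧
      canonNatListFn u = encodingNatBool.listBool.encode (decNatList u) :=
  canonListFnC_eq encodingNatBool decodeNat decode_nat canonF_eq_encodeNat_decodeNat
    length_canonF_le' (by norm_num) u

/-- `|canonNatListFn u| ≤ 4 |u| + 2`. [cite: AroraBarak2009, §0.1 (codes of lists)] -/
theorem length_canonNatListFn_le (u : List Bool) : (canonNatListFn u).length ≤ 4 * u.length + 2 :=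
  length_canonListFnC_le (C := 2) length_canonF_le' (by norm_num) u

/-- **Canonicalisation of tableau codes** (clip `6 = 4 + 2`). [cite: AroraBarak2009, §0.1] -/
def canonTabFn : List Bool → List Bool := canonListFnC 6 canonNatListFn

/-- `canonTabFn ∈ FP`. [cite: AroraBarak2009, §1.3] -/
theorem canonTabFn_mem_FP : canonTabFn ∈ FP :=
  canonListFnC_mem_FP 6 (canonListFnC_mem_FP 2 canonF_mem_FP)

/-- **The tableau decoder is total and `canonTabFn x = tableauEncoding.encode (decTab x)`.**
[cite: AroraBarak2009, §0.1 (codes of lists)] -/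
theorem canonTabFn_eq (x : List Bool) :
    tableauEncoding.decode x = some (decTab x) ∧ canonTabFn x = tableauEncoding.encode (decTab x) :=
  canonListFnC_eq encodingNatBool.listBool decNatList (fun u => (canonNatListFn_eq u).1)
    (fun u => (canonNatListFn_eq u).2) length_canonNatListFn_le (by norm_num) x

/-- The total decoder inverts the encoder. [cite: AroraBarak2009, §0.1 (codes of lists)] -/
@[simp] theorem decTab_encode (T : List (List ℕ)) : decTab (tableauEncoding.encode T) = T := by
  have h := (canonTabFn_eq (tableauEncoding.encode T)).1
  rw [tableauEncoding.decode_encode] at h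
  exact (Option.some.inj h).symm

/-- Tableaux are read in polynomial time: `x ↦ code of decTab x` is `CodeFP`. [cite: AroraBarak2009, §1.3] -/
theorem decTabFP : CodeFP strE tabE decTab :=
  of_fn canonTabFn canonTabFn_mem_FP fun x => by rw [← tabE_eq]; exact (canonTabFn_eq x).2

/-! ### The normalised instance of a string -/

/-- **Normalisation**: a tableau code is read as its tableau, every other string as the fixed
tableau `T₀` (to be chosen outside `S`). [cite: AroraBarak2009, Def. 2.7 (a fixed no-instance for non-codes)] -/
def tabNorm (T₀ : List (List ℕ)) (x : List Bool) : List (List ℕ) :=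
  if tableauEncoding.encode (decTab x) = x then decTab x else T₀

/-- On codes the normalisation is the decoded tableau. [cite: AroraBarak2009, Def. 2.7 (Karp reductions: treatment of non-codes)] -/
@[simp] theorem tabNorm_encode (T₀ T : List (List ℕ)) : tabNorm T₀ (tableauEncoding.encode T) = T := by
  simp [tabNorm]

/-- On codes the normalisation is the decoded tableau. [cite: AroraBarak2009, Def. 2.7 (Karp reductions: treatment of non-codes)] -/
theorem tabNorm_of_eq {T₀ : List (List ℕ)} {x : List Bool} (h : tableauEncoding.encode (decTab x) = x) :
    tabNorm T₀ x = decTab x := by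
  simp [tabNorm, h]

/-- Off the codes the normalisation is `T₀`. [cite: AroraBarak2009, Def. 2.7 (Karp reductions: treatment of non-codes)] -/
theorem tabNorm_of_ne {T₀ : List (List ℕ)} {x : List Bool} (h : tableauEncoding.encode (decTab x) ≠ x) :
    tabNorm T₀ x = T₀ := by
  simp [tabNorm, h]

/-- **The normalisation is computed on strings by a polynomial-time function** (`x ↦ code of
tabNorm T₀ x`). [cite: AroraBarak2009, §1.3] -/
theorem tabNormFP (T₀ : List (List ℕ)) : CodeFP strE tabE (tabNorm T₀) := by
  have hre : CodeFP strE strE (fun x => tabE (decTab x)) := decTabFP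
  have hinj : Function.Injective strE := fun _ _ h => h
  have htest : CodeFP strE bitE (fun x => decide (tabE (decTab x) = x)) :=
    ((eq hinj).comp (hre.pair (CodeFP.id strE))).congr fun _ => rfl
  exact (htest.ite decTabFP (const _ T₀)).congr fun x => by
    unfold tabNorm; rw [tabE_eq]; simp only [decide_eq_true_eq]

/-- Membership of the normalised instance decides the language of codes (when `T₀ ∉ S`).
[cite: AroraBarak2009, §1.2 (decision problems as languages)] -/
theorem tabNorm_mem_iff {S : Set (List (List ℕ))} {T₀ : List (List ℕ)} (hT₀ : T₀ ∉ S)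
    (x : List Bool) : tabNorm T₀ x ∈ S ↔ x ∈ tableauEncoding.toLanguage S := by
  by_cases hx : tableauEncoding.encode (decTab x) = x
  · conv_rhs => rw [← hx]
    rw [Encoding.mem_toLanguage_iff, tabNorm, if_pos hx]
  · rw [tabNorm_of_ne hx]
    refine ⟨fun h => absurd h hT₀, fun h => ?_⟩
    obtain ⟨T, -, rfl⟩ := h
    exact absurd (by rw [decTab_encode]) hx

/-! ### The parameterised problem and its membership in `SE` -/

/-- **The parameterised tableau problem of `S`** with parameter `g (numLabels T) - 1` on the code
of `T` (`0` off the codes). [cite: ImpagliazzoPaturiZaneJCSS2001, §2 (parameterised problems)] -/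
def subexpParam (S : Set (List (List ℕ))) (g : ℕ → ℕ) : ParamProblem :=
  ParamProblem.ofEncoding tableauEncoding S fun T => g (numLabels T) - 1

/-- The language of `subexpParam S g`. [cite: ImpagliazzoPaturiZaneJCSS2001, §2 (parameterised problems)] -/
@[simp] theorem subexpParam_lang (S : Set (List (List ℕ))) (g : ℕ → ℕ) :
    (subexpParam S g).lang = tableauEncoding.toLanguage S := rfl

/-- The parameter of `subexpParam S g` on a code. [cite: ImpagliazzoPaturiZaneJCSS2001, §2 (parameterised problems)] -/
@[simp] theorem subexpParam_param_encode (S : Set (List (List ℕ))) (g : ℕ → ℕ) (T : List (List ℕ)) :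
    (subexpParam S g).param (tableauEncoding.encode T) = g (numLabels T) - 1 :=
  ParamProblem.ofEncoding_param_encode _ _ _ _

/-- The parameter of `subexpParam S g` on any string, through the total decoder. [cite: ImpagliazzoPaturiZaneJCSS2001, §2 (parameterised problems)] -/
theorem subexpParam_param (S : Set (List (List ℕ))) (g : ℕ → ℕ) (x : List Bool) :
    (subexpParam S g).param x =
      if tableauEncoding.encode (decTab x) = x then g (numLabels (decTab x)) - 1 else 0 := by
  unfold subexpParam ParamProblem.ofEncoding
  simp only [(canonTabFn_eq x).1]

/-- A polynomial is a `Gb 0`-bound. [folklore] -/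
private theorem gb_poly (p : Polynomial ℕ) (q : List Bool → ℕ) :
    SerfSim.Gb 0 q fun x => ((p.eval x.length : ℕ) : ℝ) := by
  obtain ⟨c, k, hck⟩ := exists_eval_le_mul_pow_add p
  refine ⟨2 * c + k, fun x => ?_⟩
  have h1 : p.eval x.length ≤ (2 * c + k) * (x.length + 1) ^ (2 * c + k) := by
    have e1 := hck x.length
    have e2 : x.length ^ k ≤ (x.length + 1) ^ (2 * c + k) :=
      (Nat.pow_le_pow_left (Nat.le_succ _) k).trans (Nat.pow_le_pow_right (Nat.succ_pos _) (by omega))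
    have e3 : 1 ≤ (x.length + 1) ^ (2 * c + k) := Nat.one_le_pow _ _ (Nat.succ_pos _)
    nlinarith
  have h2 : ((p.eval x.length : ℕ) : ℝ) ≤ ((2 * c + k : ℕ) : ℝ) * ((x.length : ℝ) + 1) ^ (2 * c + k) := by
    exact_mod_cast h1
  simpa using h2

open Literature.Computability.FineGrained in
/-- **A `2^{o(g(n))}` decider for the tableau problem `S` puts `subexpParam S g` in `SE`.**
Given `ε > 0`, run the polynomial-time normalisation `x ↦ code of tabNorm T₀ x` and then the
`HasSubexpDecider` machine with exponent `δ = min ε 1`: on the code of `T` the time is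
`O(2^{δ g(numLabels T)} poly(|x|)) = O(2^{ε (g(numLabels T) - 1)} poly(|x|))`, off the codes it is
polynomial (the decider runs on the fixed code of `T₀`). [cite: AroraBarak2009, §1.3 (composition)]
[cite: ImpagliazzoPaturiZaneJCSS2001, §2 (SE)] -/
theorem subexpParam_mem_SE {S : Set (List (List ℕ))} {g : ℕ → ℕ} {T₀ : List (List ℕ)}
    (hT₀ : T₀ ∉ S) (h : HasSubexpDecider S g) : subexpParam S g ∈ SE := by
  classical
  obtain ⟨T, hT, M₂, hM₂⟩ := h
  obtain ⟨f, hf, hfeq⟩ := tabNormFP T₀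
  obtain ⟨p, M₁, hM₁⟩ := hf
  intro ε hε
  -- the front end computes the code of the normalised tableau
  have h₁ : ∀ x : List Bool, M₁.OutputsWithin x (tableauEncoding.encode (tabNorm T₀ x)) (p.eval x.length) := by
    intro x
    have e : f x = tableauEncoding.encode (tabNorm T₀ x) := by rw [tabE_eq]; exact hfeq x
    have hx := hM₁ x
    dsimp only [id] at hx
    rwa [e] at hx
  -- the composite machine and its time
  let T' : List Bool → ℕ := fun x =>
    T (g (numLabels (tabNorm T₀ x))) (tableauEncoding.encode (tabNorm T₀ x)).length + p.eval x.length
  refine ⟨T', M₁.comp M₂, ?_, fun x => ?_⟩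
  · -- time accounting
    set δ : ℝ := min ε 1 with hδ
    have hδpos : 0 < δ := lt_min hε one_pos
    have hδε : δ ≤ ε := min_le_left _ _
    have hδ1 : δ ≤ 1 := min_le_right _ _
    obtain ⟨c, hc⟩ := hT δ hδpos
    have hpoly := (gb_poly p (subexpParam S g).param).mono hε.le
    -- the decider part
    have hdec : SerfSim.Gb ε (subexpParam S g).param fun x =>
        (T (g (numLabels (tabNorm T₀ x))) (tableauEncoding.encode (tabNorm T₀ x)).length : ℝ) := by
      -- the constant cost on junk strings
      set K₀ : ℕ := T (g (numLabels T₀)) (tableauEncoding.encode T₀).length with hK₀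
      refine ⟨2 * c + K₀, fun x => ?_⟩
      dsimp only
      rw [subexpParam_param]
      by_cases hx : tableauEncoding.encode (decTab x) = x
      · rw [if_pos hx, tabNorm_of_eq hx, hx]
        set n : ℕ := g (numLabels (decTab x)) with hn
        have h1 := hc n x.length
        have hexp : (2 : ℝ) ^ (δ * n) ≤ 2 * (2 : ℝ) ^ (ε * ((n - 1 : ℕ) : ℝ)) := by
          have hle : δ * n ≤ ε * ((n - 1 : ℕ) : ℝ) + 1 := by
            have hn1 : (n : ℝ) ≤ ((n - 1 : ℕ) : ℝ) + 1 := by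
              have : n ≤ (n - 1) + 1 := by omega
              exact_mod_cast this
            have h0 : (0 : ℝ) ≤ ((n - 1 : ℕ) : ℝ) := Nat.cast_nonneg _
            nlinarith
          calc (2 : ℝ) ^ (δ * n) ≤ (2 : ℝ) ^ (ε * ((n - 1 : ℕ) : ℝ) + 1) :=
                Real.rpow_le_rpow_of_exponent_le one_le_two hle
            _ = 2 * (2 : ℝ) ^ (ε * ((n - 1 : ℕ) : ℝ)) := by
                rw [Real.rpow_add two_pos, Real.rpow_one, mul_comm]
        have hP : (1 : ℝ) ≤ (x.length : ℝ) + 1 := by simp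
        have hpow : ((x.length : ℝ) + 1) ^ c ≤ ((x.length : ℝ) + 1) ^ (2 * c + K₀) :=
          pow_le_pow_right₀ hP (by omega)
        have hE : (0 : ℝ) ≤ (2 : ℝ) ^ (ε * ((n - 1 : ℕ) : ℝ)) := by positivity
        calc (T n x.length : ℝ) ≤ c * (2 : ℝ) ^ (δ * n) * ((x.length : ℝ) + 1) ^ c := h1
          _ ≤ c * (2 * (2 : ℝ) ^ (ε * ((n - 1 : ℕ) : ℝ))) * ((x.length : ℝ) + 1) ^ (2 * c + K₀) := by
              gcongr
          _ = ((2 * c : ℕ) : ℝ) * (2 : ℝ) ^ (ε * ((n - 1 : ℕ) : ℝ)) * ((x.length : ℝ) + 1) ^ (2 * c + K₀) := by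
              push_cast; ring
          _ ≤ ((2 * c + K₀ : ℕ) : ℝ) * (2 : ℝ) ^ (ε * ((n - 1 : ℕ) : ℝ)) *
                ((x.length : ℝ) + 1) ^ (2 * c + K₀) := by
              gcongr; exact_mod_cast Nat.le_add_right _ _
      · rw [if_neg hx, tabNorm_of_ne hx, ← hK₀]
        have hE : (1 : ℝ) ≤ (2 : ℝ) ^ (ε * ((0 : ℕ) : ℝ)) := by simp
        have hP : (1 : ℝ) ≤ ((x.length : ℝ) + 1) ^ (2 * c + K₀) := one_le_pow₀ (by simp)
        calc (K₀ : ℝ) = K₀ * 1 * 1 := by ring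
          _ ≤ ((2 * c + K₀ : ℕ) : ℝ) * (2 : ℝ) ^ (ε * ((0 : ℕ) : ℝ)) * ((x.length : ℝ) + 1) ^ (2 * c + K₀) := by
              gcongr; exact_mod_cast Nat.le_add_left _ _
    have htot := hdec.add hpoly
    exact SerfSim.Gb.isSubexpTimeBound (htot.of_le fun x => by simp [T'])
  · -- correctness: the composite decides the language
    have h₂ := hM₂ (tabNorm T₀ x)
    have hcomp := Turing.TM2ComputableAux.comp_outputsWithin M₁ M₂ (h₁ x) h₂
    have hval : decide (tabNorm T₀ x ∈ S) = (subexpParam S g).lang.boolIndicator x := by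
      rw [subexpParam_lang]
      by_cases hm : tabNorm T₀ x ∈ S
      · rw [decide_eq_true hm, eq_comm, ← Set.mem_iff_boolIndicator]
        exact (tabNorm_mem_iff hT₀ x).1 hm
      · rw [decide_eq_false hm, eq_comm, ← Set.notMem_iff_boolIndicator]
        exact fun h' => hm ((tabNorm_mem_iff hT₀ x).2 h')
    dsimp only at hcomp
    rw [hval] at hcomp
    exact hcomp

end BDI2020

end Literature.Computability.AlgebraicComplexity

end
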